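import Summits.BirchSwinnertonDyer.BirchSwinnertonDyer.Theorems.KolyvaginRankRigidityAtTwoChebotarevTwoLevel
import Summits.BirchSwinnertonDyer.BirchSwinnertonDyer.Theorems.KolyvaginRankRigidityAtTwoWalkCharacters
import HarnessLib

/-!
# Crux U1 `KolyvaginBoundedDefectAtTwo` (stmt-BirchSwinnertonDyer-28083), LINE 17 `regular_core_rigidity` v3,
# stub S1b `stub_nearCoreExistenceAtTwo` — ENGINE ADAPTER II: the killing character of a walk step

Width seat `bsd-line-krr2-p2` g14 (ONE READER on S1b); `--supports stmt-BirchSwinnertonDyer-28083` (helper). THEOREMS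
ONLY; nothing here proves S1b, U1, a rung or BSD. BSD is NOT proved.

At a step of the regular-prime walk the Frobenius of the new prime is chosen so that the local images at the new
place `v` of the classes of the current vertex `S = H¹_{𝓕(c)}(K, E[2^k])` are the values of a CHARACTER of the
restricted classes: zero on the frame classes `y i` to be kept (they survive into `H¹_{𝓕(cℓ)}`), of maximal order
on the one or two cutters `p`, `q`. **`exists_killing_character`**: for a finite `S`, classes `y : Fin m → S` and
`p q ∈ S` there is an additive `f : S → ZMod 2^k`, factoring through the restriction to `Γ_{K(E[2^(k+1)])}`, with
`f (y i) = 0` and, for `x ∈ {p, q}`, `a • f x = 0 ↔ a • x ∈ ⟨y⟩ + ker(res)` — i.e. `f x` has the order of `x` in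
`res(S)/⟨res y⟩`. PROOF: restrict to `Γ_{K(E[2^(k+1)])}` (`h1EvalHom`), pass to the quotient of the function group by
the span of the `res (y i)`, and apply the two-element character lemma `exists_addMonoidHom_zmod_pow_addOrderOf_eq_pair`
(p683265; Baer's criterion for `ZMod 2^k`). [cite: MazurRubin2004, §4.1, proof of Prop. 4.1.5]
[cite: McCallumLMS1991, §3 Prop. 3.1]
Design: no definitions; `K : Type`; axioms `propext`, `Classical.choice`, `Quot.sound`.
-/

set_option autoImplicit false
-- the Theorems namespace of this sub repeats the summit name by design (D-0017 nested layout)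
set_option linter.dupNamespace false

noncomputable section

open scoped Classical
open Function WeierstrassCurve Field Finset
open Literature.NumberTheory.EllipticCurves Literature.NumberTheory.EllipticCurves.KolyvaginPairing
open Literature.NumberTheory.GaloisRepresentations
open Summit.BirchSwinnertonDyer.BirchSwinnertonDyer.Theorems.KolyvaginAtTwo.WalkAlgebra

namespace Summit.BirchSwinnertonDyer.BirchSwinnertonDyer.Theorems.KolyvaginAtTwo.RegularValueEngine

universe u

variable {K : Type u} [Field K] [NumberField K] (W : WeierstrassCurve ℚ)

/-- **THE KILLING CHARACTER OF A WALK STEP.** `S ≤ H¹(K, E[2^k])`, classes `y i ∈ S` (to be killed), `p, q ∈ S`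
(the cutters). There is an additive `f : S → ZMod 2^k` which (1) only depends on the restriction to
`Γ_{K(E[2^(k+1)])}`, (2) kills every `y i`, and (3) for `x = p` and `x = q`: `a • f x = 0` iff `a • x` restricts like an
integer combination of the `y i` (so `addOrderOf (f x)` is the order of `x` in `res(S)/⟨res y⟩`).
[cite: MazurRubin2004, §4.1, proof of Prop. 4.1.5] [cite: McCallumLMS1991, §3 Prop. 3.1] -/
theorem exists_killing_character {k : ℕ} (S : AddSubgroup (galH1Torsion (W.baseChange K) ((2 ^ k : ℕ) : ℤ)))
    {m : ℕ} (y : Fin m → galH1Torsion (W.baseChange K) ((2 ^ k : ℕ) : ℤ)) (hy : ∀ i, y i ∈ S)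
    {p q : galH1Torsion (W.baseChange K) ((2 ^ k : ℕ) : ℤ)} (hp : p ∈ S) (hq : q ∈ S) :
    ∃ f : S →+ ZMod (2 ^ k),
      (∀ x x' : S, (∀ ρ ∈ torsionFixing (W.baseChange K) ((2 ^ (k + 1) : ℕ) : ℤ),
        h1Eval (W.baseChange K) ((2 ^ k : ℕ) : ℤ) (x : galH1Torsion (W.baseChange K) ((2 ^ k : ℕ) : ℤ)) ρ =
          h1Eval (W.baseChange K) ((2 ^ k : ℕ) : ℤ) (x' : galH1Torsion (W.baseChange K) ((2 ^ k : ℕ) : ℤ)) ρ) →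
        f x = f x') ∧
      (∀ i, f ⟨y i, hy i⟩ = 0) ∧
      (∀ a : ℤ, a • f ⟨p, hp⟩ = 0 ↔ ∃ b : Fin m → ℤ, ∀ ρ ∈ torsionFixing (W.baseChange K) ((2 ^ (k + 1) : ℕ) : ℤ),
        h1Eval (W.baseChange K) ((2 ^ k : ℕ) : ℤ) (a • p - ∑ i, b i • y i) ρ = 0) ∧
      (∀ a : ℤ, a • f ⟨q, hq⟩ = 0 ↔ ∃ b : Fin m → ℤ, ∀ ρ ∈ torsionFixing (W.baseChange K) ((2 ^ (k + 1) : ℕ) : ℤ),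
        h1Eval (W.baseChange K) ((2 ^ k : ℕ) : ℤ) (a • q - ∑ i, b i • y i) ρ = 0) := by
  let n : ℤ := ((2 ^ k : ℕ) : ℤ)
  let TF := torsionFixing (W.baseChange K) ((2 ^ (k + 1) : ℕ) : ℤ)
  have hle : TF ≤ torsionFixing (W.baseChange K) n :=
    KolyvaginLowerBoundAtTwo.torsionFixing_le_of_dvd _ ⟨2, by simp only [n]; push_cast; ring⟩
  -- restriction, span of the `res (y i)`, quotient
  let res : galH1Torsion (W.baseChange K) n →+ (TF → geomTorsion (W.baseChange K) n) :=
    AddMonoidHom.pi fun ρ : TF ↦ h1EvalHom (W.baseChange K) n (hle ρ.2)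
  have hres : ∀ x (ρ : TF), res x ρ = h1Eval (W.baseChange K) n x ρ := fun _ _ ↦ rfl
  have hres0 : ∀ x : galH1Torsion (W.baseChange K) n,
      res x = 0 ↔ ∀ ρ ∈ TF, h1Eval (W.baseChange K) n x ρ = 0 := fun x ↦ by
    constructor
    · intro h ρ hρ
      have := congrFun h ⟨ρ, hρ⟩
      rwa [hres] at this
    · intro h
      funext ρ
      rw [hres, Pi.zero_apply]
      exact h ρ ρ.2
  let B : (Fin m → ℤ) →+ (TF → geomTorsion (W.baseChange K) n) :=
    { toFun := fun b ↦ ∑ i, b i • res (y i)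
      map_zero' := by simp
      map_add' := fun b b' ↦ by
        simp only [Pi.add_apply, add_smul]
        exact Finset.sum_add_distrib }
  have hB : ∀ b, B b = ∑ i, b i • res (y i) := fun _ ↦ rfl
  let H := B.range
  let φ : galH1Torsion (W.baseChange K) n →+ (TF → geomTorsion (W.baseChange K) n) ⧸ H :=
    (QuotientAddGroup.mk' H).comp res
  have hφ : ∀ x, φ x = 0 ↔ ∃ b : Fin m → ℤ, res x = ∑ i, b i • res (y i) := fun x ↦ by
    change ((res x : (TF → geomTorsion (W.baseChange K) n) ⧸ H) : _) = 0 ↔ _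
    rw [QuotientAddGroup.eq_zero_iff]
    constructor
    · rintro ⟨b, hb⟩; exact ⟨b, by rw [← hb, hB]⟩
    · rintro ⟨b, hb⟩; exact ⟨b, by rw [hB, hb]⟩
  -- the character on the finite `2^k`-torsion group `φ(S)`
  let ψ : S →+ S.map φ := φ.addSubgroupMap S
  have hψ : ∀ x : S, (ψ x : (TF → geomTorsion (W.baseChange K) n) ⧸ H) = φ x := fun _ ↦ rfl
  have h2k : ∀ g : S.map φ, 2 ^ k • g = 0 := by
    rintro ⟨_, x, hx, rfl⟩
    apply Subtype.ext
    rw [AddSubgroup.coe_nsmul, AddSubgroup.coe_zero, ← map_nsmul]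
    have h0 : (2 ^ k) • res x = 0 := by
      funext ρ
      rw [Pi.smul_apply, Pi.zero_apply]
      have := (W.baseChange K).natAbs_nsmul_geomTorsion (res x ρ)
      rwa [Int.natAbs_natCast] at this
    change QuotientAddGroup.mk' H (res ((2 ^ k) • x)) = 0
    rw [map_nsmul, h0, map_zero]
  obtain ⟨χ, hχp, hχq⟩ := exists_addMonoidHom_zmod_pow_addOrderOf_eq_pair h2k (ψ ⟨p, hp⟩) (ψ ⟨q, hq⟩)
  -- translation of `a • χ (ψ x) = 0`
  have hkey : ∀ (x : galH1Torsion (W.baseChange K) n) (hx : x ∈ S),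
      addOrderOf (χ (ψ ⟨x, hx⟩)) = addOrderOf (ψ ⟨x, hx⟩) →
      ∀ a : ℤ, a • χ (ψ ⟨x, hx⟩) = 0 ↔ ∃ b : Fin m → ℤ, ∀ ρ ∈ TF,
        h1Eval (W.baseChange K) n (a • x - ∑ i, b i • y i) ρ = 0 := by
    intro x hx hord a
    rw [← addOrderOf_dvd_iff_zsmul_eq_zero, hord, addOrderOf_dvd_iff_zsmul_eq_zero, ← map_zsmul]
    have e1 : (ψ (a • ⟨x, hx⟩) = 0) ↔ φ (a • x) = 0 := by
      constructor
      · intro h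
        have h' := congrArg Subtype.val h
        rw [hψ, AddSubgroup.coe_zero, AddSubgroup.coe_zsmul] at h'
        exact h'
      · intro h
        exact Subtype.ext (by rw [hψ, AddSubgroup.coe_zero, AddSubgroup.coe_zsmul]; exact h)
    rw [e1, hφ]
    refine exists_congr fun b ↦ ?_
    rw [← sub_eq_zero, ← hres0, map_sub, map_sum]
    simp only [map_zsmul]
  refine ⟨χ.comp ψ, fun x x' hxx' ↦ ?_, fun i ↦ ?_, hkey p hp hχp, hkey q hq hχq⟩
  · -- factors through the restriction
    have hr : res (x : galH1Torsion (W.baseChange K) n) = res (x' : galH1Torsion (W.baseChange K) n) := by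
      funext ρ
      rw [hres, hres]
      exact hxx' ρ ρ.2
    have : ψ x = ψ x' := Subtype.ext (by rw [hψ, hψ]; change QuotientAddGroup.mk' H (res x) = _; rw [hr]; rfl)
    rw [AddMonoidHom.comp_apply, AddMonoidHom.comp_apply, this]
  · -- kills `y i`
    have : ψ ⟨y i, hy i⟩ = 0 := by
      apply Subtype.ext
      rw [hψ, AddSubgroup.coe_zero]
      exact (hφ _).mpr ⟨Pi.single i 1, by simp [Pi.single_apply]⟩
    rw [AddMonoidHom.comp_apply, this, map_zero]

end Summit.BirchSwinnertonDyer.BirchSwinnertonDyer.Theorems.KolyvaginAtTwo.RegularValueEngine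

end
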